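import Summits.BirchSwinnertonDyer.BirchSwinnertonDyer.Theorems.Rank2ShaKerPolyCertEval
import HarnessLib

/-!
# BirchSwinnertonDyer — rank-2 `Ш[p^∞]` cell: kernel-polynomial certificate, III — SOUNDNESS:
# a verified certificate yields a rational `p`-line, so `E[p]` is reducible (`KerPoly.red_of_check`)

HONEST FRAMING (cell `b2b-bsdr2sha`, run/shared/lean/b2b/bsd-rank2-sha/, ENGINE 3 = IMC bookkeeping):
per-pair certified theorems «cited hypotheses ∧ certified computation ⇒ `Ш(E/ℚ)[p^∞]` finite of order
`p^k`»; NO claim on BSD in rank `≥ 2`; nothing about `Ш` here — this file decides ONE hypothesis of the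
reducible rows, the binder `hred : ¬ E[p] irreducible` of the tree's Wuthrich-2014 adapter
`padicBSD_inequality_of_wuthrich16_odd_of_coeff_ne_zero_of_optimal`, from a kernel-polynomial
certificate verified by `KerPoly.Cert.check` (`Rank2ShaKerPolyCert.lean`; semantics
`Rank2ShaKerPolyCertEval.lean`).

THE ARGUMENT (Silverman *AEC* III.2.3 for the group law; Greenberg–Vatsal 2000 p. 4 for "rational
`p`-isogeny kernel" = `IsRationalLine`). Let `x₁ ∈ ℚ̄` be a root of the monic `H` (degree `≥ 1`) and
`P = (x₁, y₁) ∈ E(ℚ̄)` a point above it. §5: the certificate's chord-tangent steps, read through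
`evalB` at `(x₁, y₁)`, ARE Mathlib's affine addition — the certified inverse of the denominator shows the
tangent (first step, `Affine.Point.add_self_of_Y_ne`) resp. secant (`Affine.Point.add_of_X_ne`) formula
applies, the certified slope equals Mathlib's `slope`, and the certified coordinates equal
`Affine.addX`/`Affine.addY` (`step_first_sound`, `step_next_sound`); by induction the `j`-th step is
`(j + 2) • P` (`stepsOK_sound`). §6: test (T) `P_{d+1} = −P_d` gives `(2d+1) • P = O`
(`Affine.Point.add_of_Y_eq`), so `P` has order `p = 2d + 1`; for `σ ∈ Γ_ℚ`, `σP = (σx₁, σy₁)` has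
abscissa a root of `H` (`smul_evalL`), hence by the root identity (R) `σx₁ = x(kP)` for some `k ≤ d`,
hence `σP = ±kP` (`Affine.Y_eq_of_X_eq`); so `ℤP ≤ E[p]` is a `Γ_ℚ`-stable subgroup of order `p`
(`exists_isRationalLine_of_check`), and `E[p]` is reducible by the tree's
`not_hasIrreducibleModPGaloisRep_of_isRationalLine` (`red_of_check`, `red_of_check_baseChange`).
USE (tier files): `KerPoly.red_of_check (h : c.check R.e p = true) W hW` with `h` by `decide +kernel`
(certificates: `Rank2ShaKerPolyCertsNNN.lean`). Theorems only; no definition, no named fact, no axiom.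
References: J. H. Silverman, *The Arithmetic of Elliptic Curves*, GTM 106 (2009), III.2.3, III.4
[SilvermanAEC2009]; R. Greenberg, V. Vatsal, Invent. Math. 142 (2000), p. 4 [GreenbergVatsal2000];
C. Wuthrich, J. Algebraic Geom. 23 (2014), Thm. 16 (the consumer) [Wuthrich2014].
-/

set_option autoImplicit false

-- single-conjunct summit: `Summit.BirchSwinnertonDyer.BirchSwinnertonDyer.…` repeats the name by design
set_option linter.dupNamespace false

open WeierstrassCurve Polynomial Literature.NumberTheory.EllipticCurves
  Literature.NumberTheory.EllipticCurves.Rank1Residual Field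

namespace Summit.BirchSwinnertonDyer.BirchSwinnertonDyer.Rank2Sha

namespace KerPoly

/-! ### §5. The steps compute the multiples `2P, 3P, …` (Silverman *AEC* III.2.3) -/

section Steps

open scoped Classical

variable {W : WeierstrassCurve ℚ}

/-- **The doubling step.** If `(x_k, y_k)` evaluates to `P = (x₁, y₁)` with `H(x₁) = 0` and the first
step verifies, then `P + P` is the affine point `(s.x, s.y)(x₁, y₁)` (tangent case of Mathlib's
`slope`, `Affine.Point.add_self_of_Y_ne`). [folklore] -/
theorem step_first_sound {x₁ y₁ : AlgebraicClosure ℚ}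
    (h₁ : (W.baseChange (AlgebraicClosure ℚ)).toAffine.Nonsingular x₁ y₁)
    {H : List ℚ} (hH : evalL x₁ H = 0) {xk yk : B} (hxk : evalB x₁ y₁ xk = x₁)
    (hyk : evalB x₁ y₁ yk = y₁) {s : Step} (hs : stepOK (Crv.of W) H true xk yk s = true) :
    ∃ (x' y' : AlgebraicClosure ℚ) (h' : (W.baseChange (AlgebraicClosure ℚ)).toAffine.Nonsingular x' y'),
      (Affine.Point.some x₁ y₁ h₁ : W.geomPoints) + (Affine.Point.some x₁ y₁ h₁ : W.geomPoints) =
          (Affine.Point.some x' y' h' : W.geomPoints) ∧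
        x' = evalB x₁ y₁ s.x ∧ y' = evalB x₁ y₁ s.y := by
  obtain ⟨e₁, e₂, e₃, e₄, e₆⟩ := baseChange_a W
  have heq := sq_eq_of_equation W h₁.left
  simp only [stepOK, if_true, Bool.and_eq_true] at hs
  obtain ⟨⟨⟨c1, c2⟩, c3⟩, c4⟩ := hs
  have hw := congB_sound x₁ y₁ hH c1
  rw [evalB_mulB _ _ _ heq, evalB_oneB] at hw
  have hden : evalB x₁ y₁ (([(Crv.of W).a₃, (Crv.of W).a₁], [2]) : B) =
      y₁ - (W.baseChange (AlgebraicClosure ℚ)).toAffine.negY x₁ y₁ := by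
    simp only [evalB, evalL_cons, evalL_nil, Crv.of, Affine.negY, e₁, e₃, map_ofNat]; ring
  rw [hden] at hw
  have hy : y₁ ≠ (W.baseChange (AlgebraicClosure ℚ)).toAffine.negY x₁ y₁ := by
    intro e; rw [sub_eq_zero.mpr e, mul_zero] at hw; exact zero_ne_one hw
  -- the slope
  have hlam := congB_sound x₁ y₁ hH c2
  rw [evalB_mulB _ _ _ heq] at hlam
  have hnum : evalB x₁ y₁ (([(Crv.of W).a₄, 2 * (Crv.of W).a₂, 3], [-(Crv.of W).a₁]) : B) =
      3 * x₁ ^ 2 + 2 * (W.baseChange (AlgebraicClosure ℚ)).toAffine.a₂ * x₁ +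
        (W.baseChange (AlgebraicClosure ℚ)).toAffine.a₄ -
        (W.baseChange (AlgebraicClosure ℚ)).toAffine.a₁ * y₁ := by
    simp only [evalB, evalL_cons, evalL_nil, Crv.of, e₁, e₂, e₄, map_ofNat, map_mul, map_neg]; ring
  have hslope : (W.baseChange (AlgebraicClosure ℚ)).toAffine.slope x₁ x₁ y₁ y₁ = evalB x₁ y₁ s.lam := by
    rw [Affine.slope_of_Y_ne rfl hy, div_eq_mul_of_mul_eq_one hw, ← hnum, hlam]
  -- the new coordinates
  have hx := congB_sound x₁ y₁ hH c3
  simp only [evalB_subB, evalB_addB, evalB_mulB _ _ _ heq, evalB_smulB, evalB_constB, evalB_PX, hxk] at hx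
  have hy' := congB_sound x₁ y₁ hH c4
  simp only [evalB_subB, evalB_addB, evalB_negB, evalB_mulB _ _ _ heq, evalB_smulB, evalB_constB,
    hxk, hyk] at hy'
  have hX : (W.baseChange (AlgebraicClosure ℚ)).toAffine.addX x₁ x₁ (evalB x₁ y₁ s.lam) =
      evalB x₁ y₁ s.x := by
    simp only [Affine.addX, Crv.of, e₁, e₂] at hx ⊢
    linear_combination hx
  have hY : (W.baseChange (AlgebraicClosure ℚ)).toAffine.addY x₁ x₁ y₁ (evalB x₁ y₁ s.lam) =
      evalB x₁ y₁ s.y := by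
    rw [Affine.addY, Affine.negAddY, hX]
    simp only [Affine.negY, Crv.of, e₁, e₃] at hy' ⊢
    linear_combination hy'
  exact ⟨_, _, Affine.nonsingular_add h₁ h₁ fun hxy => hy hxy.right,
    Affine.Point.add_self_of_Y_ne hy, by rw [hslope, hX], by rw [hslope, hY]⟩

/-- **The chord step.** If `Q = (x_k, y_k)(x₁, y₁)` with `H(x₁) = 0` and the step verifies, then
`Q + P` is the affine point `(s.x, s.y)(x₁, y₁)` (secant case of Mathlib's `slope`,
`Affine.Point.add_of_X_ne`). [folklore] -/
theorem step_next_sound {x₁ y₁ : AlgebraicClosure ℚ}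
    (h₁ : (W.baseChange (AlgebraicClosure ℚ)).toAffine.Nonsingular x₁ y₁)
    {H : List ℚ} (hH : evalL x₁ H = 0) {xk yk : B} {xq yq : AlgebraicClosure ℚ}
    (hq : (W.baseChange (AlgebraicClosure ℚ)).toAffine.Nonsingular xq yq)
    (hxk : evalB x₁ y₁ xk = xq) (hyk : evalB x₁ y₁ yk = yq)
    {s : Step} (hs : stepOK (Crv.of W) H false xk yk s = true) :
    ∃ (x' y' : AlgebraicClosure ℚ) (h' : (W.baseChange (AlgebraicClosure ℚ)).toAffine.Nonsingular x' y'),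
      (Affine.Point.some xq yq hq : W.geomPoints) + (Affine.Point.some x₁ y₁ h₁ : W.geomPoints) =
          (Affine.Point.some x' y' h' : W.geomPoints) ∧
        x' = evalB x₁ y₁ s.x ∧ y' = evalB x₁ y₁ s.y := by
  obtain ⟨e₁, e₂, e₃, e₄, e₆⟩ := baseChange_a W
  have heq := sq_eq_of_equation W h₁.left
  simp only [stepOK, Bool.false_eq_true, if_false, Bool.and_eq_true] at hs
  obtain ⟨⟨⟨c1, c2⟩, c3⟩, c4⟩ := hs
  have hw := congB_sound x₁ y₁ hH c1
  rw [evalB_mulB _ _ _ heq, evalB_oneB, evalB_subB, evalB_PX, hxk] at hw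
  have hx : xq ≠ x₁ := by
    intro e; rw [sub_eq_zero.mpr e, mul_zero] at hw; exact zero_ne_one hw
  have hlam := congB_sound x₁ y₁ hH c2
  rw [evalB_mulB _ _ _ heq, evalB_subB, evalB_PY, hyk] at hlam
  have hslope : (W.baseChange (AlgebraicClosure ℚ)).toAffine.slope xq x₁ yq y₁ = evalB x₁ y₁ s.lam := by
    rw [Affine.slope_of_X_ne hx, div_eq_mul_of_mul_eq_one hw, hlam]
  have hx' := congB_sound x₁ y₁ hH c3
  simp only [evalB_subB, evalB_addB, evalB_mulB _ _ _ heq, evalB_smulB, evalB_constB, evalB_PX, hxk] at hx'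
  have hy' := congB_sound x₁ y₁ hH c4
  simp only [evalB_subB, evalB_addB, evalB_negB, evalB_mulB _ _ _ heq, evalB_smulB, evalB_constB,
    hxk, hyk] at hy'
  have hX : (W.baseChange (AlgebraicClosure ℚ)).toAffine.addX xq x₁ (evalB x₁ y₁ s.lam) =
      evalB x₁ y₁ s.x := by
    simp only [Affine.addX, Crv.of, e₁, e₂] at hx' ⊢
    linear_combination hx'
  have hY : (W.baseChange (AlgebraicClosure ℚ)).toAffine.addY xq x₁ yq (evalB x₁ y₁ s.lam) =
      evalB x₁ y₁ s.y := by
    rw [Affine.addY, Affine.negAddY, hX]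
    simp only [Affine.negY, Crv.of, e₁, e₃] at hy' ⊢
    linear_combination hy'
  exact ⟨_, _, Affine.nonsingular_add hq h₁ fun hxy => hx hxy.left, Affine.Point.add_of_X_ne hx,
    by rw [hslope, hX], by rw [hslope, hY]⟩

/-- **The chain of steps computes the multiples.** If `(x_k, y_k)` evaluates to `m • P`
(`m = 1` when the first step is the doubling) and the chain verifies, its `j`-th step evaluates to
`(m + j + 1) • P`. [folklore] -/
theorem stepsOK_sound {x₁ y₁ : AlgebraicClosure ℚ}
    (h₁ : (W.baseChange (AlgebraicClosure ℚ)).toAffine.Nonsingular x₁ y₁)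
    {H : List ℚ} (hH : evalL x₁ H = 0) :
    ∀ (ss : List Step) (first : Bool) (xk yk : B) (m : ℕ),
      stepsOK (Crv.of W) H first xk yk ss = true →
      (first = true → m = 1) →
      (∃ (xq yq : AlgebraicClosure ℚ) (hq : (W.baseChange (AlgebraicClosure ℚ)).toAffine.Nonsingular xq yq),
        m • (Affine.Point.some x₁ y₁ h₁ : W.geomPoints) = (Affine.Point.some xq yq hq : W.geomPoints) ∧
          xq = evalB x₁ y₁ xk ∧ yq = evalB x₁ y₁ yk) →
      ∀ (j : ℕ) (hj : j < ss.length),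
        ∃ (x' y' : AlgebraicClosure ℚ) (h' : (W.baseChange (AlgebraicClosure ℚ)).toAffine.Nonsingular x' y'),
          (m + j + 1) • (Affine.Point.some x₁ y₁ h₁ : W.geomPoints) = (Affine.Point.some x' y' h' : W.geomPoints) ∧
            x' = evalB x₁ y₁ (ss[j]).x ∧ y' = evalB x₁ y₁ (ss[j]).y
  | [], _, _, _, _, _, _, _, j, hj => by simp at hj
  | s :: rest, first, xk, yk, m, hss, hfirst, hm, j, hj => by
    rw [stepsOK, Bool.and_eq_true] at hss
    obtain ⟨xq, yq, hq, hmP, hxq, hyq⟩ := hm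
    -- the point `(m + 1) • P`
    have hnext : ∃ (x' y' : AlgebraicClosure ℚ)
        (h' : (W.baseChange (AlgebraicClosure ℚ)).toAffine.Nonsingular x' y'),
        (m + 1) • (Affine.Point.some x₁ y₁ h₁ : W.geomPoints) = (Affine.Point.some x' y' h' : W.geomPoints) ∧
          x' = evalB x₁ y₁ s.x ∧ y' = evalB x₁ y₁ s.y := by
      cases first with
      | true =>
        have hm1 : m = 1 := hfirst rfl
        subst hm1
        rw [one_smul] at hmP
        have hc : xq = x₁ ∧ yq = y₁ := Affine.Point.some.inj hmP.symm
        obtain ⟨x', y', h', hadd, hx', hy'⟩ :=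
          step_first_sound h₁ hH (hxq.symm.trans hc.1) (hyq.symm.trans hc.2) hss.1
        exact ⟨x', y', h', by rw [succ_nsmul, one_smul, hadd], hx', hy'⟩
      | false =>
        obtain ⟨x', y', h', hadd, hx', hy'⟩ := step_next_sound h₁ hH hq hxq.symm hyq.symm hss.1
        exact ⟨x', y', h', by rw [succ_nsmul, hmP, hadd], hx', hy'⟩
    cases j with
    | zero => simpa using hnext
    | succ j =>
      have hj' : j < rest.length := by simpa using hj
      obtain ⟨x', y', h', hP, hx', hy'⟩ :=
        stepsOK_sound h₁ hH rest false s.x s.y (m + 1) hss.2 (fun h => Bool.noConfusion h) hnext j hj'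
      refine ⟨x', y', h', ?_, ?_, ?_⟩
      · rw [← hP]; congr 1; ring
      · rw [hx', List.getElem_cons_succ]
      · rw [hy', List.getElem_cons_succ]

end Steps

/-! ### §6. From a verified certificate to a rational `p`-line -/

section Main

open scoped Classical

/-- **Main theorem (line form).** A verified kernel-polynomial certificate for `(e, p)` yields a
rational `p`-line `ℤP ≤ E[p]` of `W = e ⊗ ℚ`: `P = (x₁, y₁)` with `H(x₁) = 0` has order `p` by
(T), and every `σP` (abscissa again a root of `H`) is `±kP` by (R). Silverman *AEC* III.2.3;
Greenberg–Vatsal 2000, p. 4. [folklore] -/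
theorem exists_isRationalLine_of_check {c : Cert} {e : WeierstrassCurve ℤ} {p : ℕ} [Fact p.Prime]
    (hc : c.check e p = true) (W : WeierstrassCurve ℚ) [W.IsElliptic]
    (hW : W = e.map (Int.castRingHom ℚ)) :
    ∃ Φ : AddSubgroup (geomTorsion W (p : ℤ)), IsRationalLine W p Φ := by
  have hprime : p.Prime := Fact.out
  have hA : Crv.ofInt e = Crv.of W := by subst hW; rfl
  simp only [Cert.check, Bool.and_eq_true, decide_eq_true_eq] at hc
  obtain ⟨⟨⟨⟨⟨hp, hh⟩, hsteps⟩, htor⟩, hyfree⟩, hroots⟩ := hc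
  rw [hA] at hsteps htor
  obtain ⟨e₁, e₂, e₃, e₄, e₆⟩ := baseChange_a W
  -- abbreviations
  set d := c.steps.length with hd
  set pts : List (B × B) := (PX, PY) :: c.steps.map fun s => (s.x, s.y) with hpts_def
  have hd1 : 1 ≤ d := by have := hprime.two_le; omega
  have hlen : pts.length = d + 1 := by simp [hpts_def, hd]
  -- a root `x₁` of `H` and a point `P = (x₁, y₁)` above it
  obtain ⟨x₁, hx₁⟩ := exists_root_algClosure c.h hh
  change evalL x₁ c.H = 0 at hx₁
  obtain ⟨y₁, hy₁⟩ := (W.baseChange (AlgebraicClosure ℚ)).exists_equation x₁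
  have h₁ : (W.baseChange (AlgebraicClosure ℚ)).toAffine.Nonsingular x₁ y₁ :=
    (W.baseChange (AlgebraicClosure ℚ)).toAffine.equation_iff_nonsingular.mp hy₁
  set P : W.geomPoints := Affine.Point.some x₁ y₁ h₁ with hP
  have hP0 : P ≠ 0 := Affine.Point.some_ne_zero h₁
  -- `pts[j]` evaluates to `(j + 1) • P`
  have hpts : ∀ (j : ℕ) (hj : j < pts.length),
      ∃ (x' y' : AlgebraicClosure ℚ) (h' : (W.baseChange (AlgebraicClosure ℚ)).toAffine.Nonsingular x' y'),
        (j + 1) • P = (Affine.Point.some x' y' h' : W.geomPoints) ∧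
          x' = evalB x₁ y₁ (pts[j]).1 ∧ y' = evalB x₁ y₁ (pts[j]).2 := by
    intro j hj
    cases j with
    | zero => exact ⟨x₁, y₁, h₁, by rw [zero_add, one_smul], by simp [hpts_def], by simp [hpts_def]⟩
    | succ j =>
      have hj' : j < c.steps.length := by rw [hlen] at hj; omega
      obtain ⟨x', y', h', hmul, hx', hy'⟩ := stepsOK_sound h₁ hx₁ c.steps true PX PY 1 hsteps
        (fun _ => rfl) ⟨x₁, y₁, h₁, by rw [one_smul], by simp, by simp⟩ j hj'
      refine ⟨x', y', h', ?_, ?_, ?_⟩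
      · rw [← hmul]; congr 1; ring
      · rw [hx']; simp [hpts_def]
      · rw [hy']; simp [hpts_def]
  -- (T): `(d + 1) • P = -(d • P)`, so `p • P = 0`
  have hpP : p • P = 0 := by
    have ha : d - 1 < pts.length := by omega
    have hb : d < pts.length := by omega
    simp only [torsionOK, List.getElem?_eq_getElem ha, List.getElem?_eq_getElem hb,
      Bool.and_eq_true] at htor
    obtain ⟨xa, ya, hna, hPa, hxa, hya⟩ := hpts (d - 1) ha
    obtain ⟨xb, yb, hnb, hPb, hxb, hyb⟩ := hpts d hb
    rw [Nat.sub_add_cancel hd1] at hPa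
    have ex := evalB_eq_zero_of_isZeroB x₁ y₁ htor.1
    rw [evalB_subB, ← hxa, ← hxb, sub_eq_zero] at ex
    have ey := evalB_eq_zero_of_isZeroB x₁ y₁ htor.2
    rw [evalB_subB, evalB_negYB, ← hxa, ← hya, ← hyb, sub_eq_zero] at ey
    have hsum : (d + 1) • P + d • P = 0 := by
      rw [hPa, hPb]
      refine Affine.Point.add_of_Y_eq ex ?_
      rw [ey, Affine.negY]; rfl
    rw [hp, show 2 * d + 1 = (d + 1) + d by ring, add_nsmul, hsum]
  -- the subgroup `ℤP ≤ E[p]`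
  have hmem : P ∈ geomTorsion W (p : ℤ) := mem_torsionBy_iff.mpr (by rw [natCast_zsmul]; exact hpP)
  set P' : geomTorsion W (p : ℤ) := ⟨P, hmem⟩ with hP'
  have hP'0 : P' ≠ 0 := fun h => hP0 (congrArg Subtype.val h)
  have hpP' : p • P' = 0 := Subtype.ext (by
    simp only [AddSubmonoidClass.coe_nsmul, ZeroMemClass.coe_zero, hP']; exact hpP)
  -- every Galois conjugate of `P` is a multiple of `P`
  rw [List.all_eq_true] at hyfree
  have hconj : ∀ σ : absoluteGaloisGroup ℚ, ∃ k : ℤ, k • P = σ • P := by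
    intro σ
    obtain ⟨hσns, hσP⟩ := smul_some W σ h₁ hP
    -- `σ x₁` is a root of `H`
    have hσroot : evalL (σ • x₁) c.H = 0 := by rw [← smul_evalL, hx₁, smul_zero]
    -- hence `σ x₁ = x(kP)` for some `k ≤ d`, by (R)
    have hprod := prod_eq_of_rootsOK x₁ (σ • x₁) hx₁ hroots
    rw [hσroot, List.prod_eq_zero_iff, List.mem_map] at hprod
    obtain ⟨u, hu, hu0⟩ := hprod
    rw [List.mem_map] at hu
    obtain ⟨b, hb, hbu⟩ := hu
    rw [List.mem_map] at hb
    obtain ⟨pt, hpt, hptb⟩ := hb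
    obtain ⟨i, hi, hipt⟩ := List.getElem_of_mem hpt
    rw [List.length_take] at hi
    have hid : i < d := lt_of_lt_of_le hi (min_le_left _ _)
    have hil : i < pts.length := by omega
    rw [List.getElem_take] at hipt
    have hyf : isZeroL pt.1.2 = true := by
      rw [hptb]; exact hyfree b (List.mem_map.mpr ⟨pt, hpt, hptb⟩)
    obtain ⟨x', y', h', hPi, hx', hy'⟩ := hpts i hil
    have hxeq : σ • x₁ = x' := by
      rw [hx', hipt, evalB, evalL_eq_zero_of_isZeroL x₁ hyf, zero_mul, add_zero, hptb, hbu]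
      exact (sub_eq_zero.mp hu0)
    rcases Affine.Y_eq_of_X_eq hσns.left h'.left hxeq with hyeq | hyeq
    · exact ⟨(i + 1 : ℕ), by rw [natCast_zsmul, hPi, hσP]; exact (some_eq_some hxeq hyeq _ _).symm⟩
    · refine ⟨-((i + 1 : ℕ) : ℤ), ?_⟩
      have e1 : σ • P = -((i + 1) • P) := by
        rw [hσP, hPi]
        exact (some_eq_some hxeq hyeq hσns _).trans (Affine.Point.neg_some h').symm
      rw [neg_zsmul, natCast_zsmul, e1]
  refine ⟨AddSubgroup.zmultiples P', ?_, ?_⟩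
  · rw [Nat.card_zmultiples, addOrderOf_eq_prime hpP' hP'0]
  · intro σ Q hQ
    obtain ⟨n, rfl⟩ := AddSubgroup.mem_zmultiples_iff.mp hQ
    rw [smul_comm]
    refine AddSubgroup.zsmul_mem _ ?_ n
    obtain ⟨k, hk⟩ := hconj σ
    refine AddSubgroup.mem_zmultiples_iff.mpr ⟨k, Subtype.ext ?_⟩
    rw [AddSubgroupClass.coe_zsmul, AddSubgroup.torsionBy.coe_smul, hP']
    exact hk

/-- **Main theorem.** If the kernel-polynomial certificate `c` verifies for the integral model `e`
and the odd prime `p` (`c.check e p = true`, decided by `decide +kernel`), then `E[p]` is a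
REDUCIBLE `Γ_ℚ`-module for every rational model `W = e ⊗ ℚ`: `E` admits a rational `p`-isogeny.
This is the binder `hred` of the tree's Wuthrich-2014 adapter. Silverman *AEC* III.2.3, III.4;
Greenberg–Vatsal 2000, p. 4. [folklore] -/
theorem red_of_check {c : Cert} {e : WeierstrassCurve ℤ} {p : ℕ} [Fact p.Prime]
    (hc : c.check e p = true) (W : WeierstrassCurve ℚ) [W.IsElliptic]
    (hW : W = e.map (Int.castRingHom ℚ)) : ¬ W.HasIrreducibleModPGaloisRep p := by
  obtain ⟨Φ, hΦ⟩ := exists_isRationalLine_of_check hc W hW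
  exact not_hasIrreducibleModPGaloisRep_of_isRationalLine hΦ

/-- **Main theorem, `baseChange` form** (the model `R.e.baseChange ℚ` of the tier kits). [folklore] -/
theorem red_of_check_baseChange {c : Cert} {e : WeierstrassCurve ℤ} {p : ℕ} [Fact p.Prime]
    (hc : c.check e p = true) [(e.baseChange ℚ).IsElliptic] :
    ¬ (e.baseChange ℚ).HasIrreducibleModPGaloisRep p :=
  red_of_check hc (e.baseChange ℚ) rfl

end Main

end KerPoly

end Summit.BirchSwinnertonDyer.BirchSwinnertonDyer.Rank2Sha
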